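import Summits.QuantumFields.BalabanUV.Beta.GAN24.BorderGaugeLegContact
import Literature.MathematicalPhysics.QuantumFieldTheory.Balaban1983to89.Beta.InterLevelTransport

/-!
# `GAN24.HessianGaugeLegContact` — the FLUCTUATION-slot pure-gauge laws of an1's rooted constraint-Hessian table `hessFFAt ρ` and of the Λ-PIECE
# `SLam N c (hessFFAt ρ L)` (any coefficient family `c`), PACKED and PAIRED: `Σ_α (H_b (x − e_α) x′ α α′ − H_b x x′ α α′) = ([x′ = x] + [x′ + e_{α′} = x] − [r_b = x] − [r_b + L·e_μ = x]) · q¹,ρ_b(α′, x′) ∕ 2`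

HONEST FRAMING (cell charter, verbatim): «discharging `BetaPertH` makes Bałaban's UV stability UNCONDITIONAL — a real constructive-QFT result;
it is NOT the continuum limit and NOT the Clay problem.»  DERIVED cell leaf (pub-balaban, G-an2-4 formalisation swarm → CRUX TEAM (2), seat
`b2b-balaban-gan24-formalise-leaf-02`, gen 47), sequel of `GAN24.BorderGaugeLegContact`, answering the second half of the row owner's LOCATED QUESTION
X-gan24p1-g19-1 (`CT3-MECHANISM-v1.2.md` §D (D2a): «… and of the Λ-piece `SLam Lc (lamCoeffK …) hessFFAt`»).  [folklore] PACKAGING of an1's kernel-level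
Ward law (K-H)ρ BY NAME — nothing of an1's is restated, no estimate, no limit, nothing cited, no `[cite:]` tag, no `def`, no `def … : Prop`; it instantiates
NO binder of the β-function wall and discharges NO letter of (CONV-C).  NEVER «G-an2-4 closed»; NOT hS0, NOT D1, NOT `BetaPertH`, NOT continuum, NOT Clay.
«not in print; our bookkeeping».
HONEST DEPENDENCY (cell records, verbatim): «continuum YM on T⁴ ⇐ BetaPertH ∧ nine spine estimates (0/9 proved); BetaPertH ⇐ (D1) ∧ (D4) ∧ CAP+tail;
G-an2-4 gates asym, D1 and NE2/3/4.»
ABSOLUTE RULE (cell charter, verbatim): «No internally-minted statement may enter as a cited fact. Every hypothesis is either kernel-proved in this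
package or a verbatim quotation of a PUBLISHED theorem with page reference. The manuscript(s) under audit are NOT citable for their own disputed steps —
they are the thing under adjudication; programme-internal (2001/route/tribunal) claims are never citable.»

THE OBJECTS (generic `d`, fine lattice `ℤ^(d+1)`, blocking `L ≥ 1`, root offset `ρ`, `e_κ := AffineAveraging.unitVec κ`; `r_b := L·y + ρ` the ROOT of the
coarse bond `b = (μ, y)`, `r_b + L·e_μ` its far endpoint).  an1's ROOTED W-HESSIAN OF THE CONSTRAINT per coarse bond, packed on the field–field block:
`H_b := AveragingHessianKernelsRooted.hessFFAt ρ L μ y : MKer`, entry `((x, inl α), (x′, inl α′)) ↦ h^ρ_b((α, x), (α′, x′)) = hessKerAt ρ L μ y (α, x) (α′, x′)`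
(ANTISYMMETRIC, `hessFFAt_antisymm`); the rooted first-order kernel `q¹,ρ_b(f) = linKerAt ρ L μ y f`; and the ABSTRACT Λ-PIECE of the step stencil
`InterLevelTransport.SLam N c Q κ′ u = −Σ_μ Σ'_y c μ y κ′ u • Q μ y` at `Q μ y := H_{(μ,y)}` — for Bałaban's data `c = lamCoeffK (KInvStep Lc (j+1)) (E2 d Lc (j+1)) Lc`
(the multiplier response), as the recursive step family `WardLocusRecursive.SrecAt` carries it at every level; here `c` is ARBITRARY.
WHICH LEG.  `H_b` has two FLUCTUATION legs (no background-bond index of its own; in the Λ-piece the family index `(κ′, u)` enters through `c` only, and that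
INDEX-leg law is an2∕leaf-10's `WardLocusStep.divV_SLam_lamCoeffK_E2_eq_zero` — transversal, TREE).  THIS FILE: the fluctuation slots, i.e. the CT-1 analogue
for the Λ-born sectors; at kernel level it is an1's (K-H)ρ `AveragingWardRootedKernels.hessKerAt_div_left` (TREE).
## What is proved ([folklore])
* §1 `H` ENTRYWISE: **`gaugeLeg_hessFFAt_inl_inl`** (first slot): `Σ_α (H_b (x − e_α) x′ (inl α) (inl α′) − H_b x x′ (inl α) (inl α′))
  = ([x′ = x] + [x′ + e_{α′} = x] − [r_b = x] − [r_b + L·e_μ = x]) · q¹,ρ_b(α′, x′) ∕ 2` — the MIDPOINT (sum of the two endpoint indicators) of the OTHER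
  fluctuation bond minus the midpoint of the coarse bond from its root, against HALF the first-order kernel; second slot **`gaugeLeg_hessFFAt_inl_inl_right`**
  (opposite sign, antisymmetry); paired with ANY `ψ` (four nonzero terms, every root): **`gaugeLeg_hessFFAt_tsum`**
  `Σ'_x ψ x · (…) = (ψ x′ + ψ(x′ + e_{α′}) − ψ(r_b) − ψ(r_b + L·e_μ)) · q¹,ρ_b(α′, x′) ∕ 2`; the `dψ`-forms for a box root **`tsum_dz_mul_hessFFAt`** ∕ **`tsum_hessFFAt_mul_dz`**.
* §2 THE Λ-PIECE (box root `ρ = toSite r`, where every coarse sum is finite — `exists_finset_near`): the entry formula `SLam_hessFFAt_inl_inl`, the multiplier rows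
  ∕ columns vanish, ANTISYMMETRY `SLam_hessFFAt_antisymm`; ENTRYWISE LAW **`gaugeLeg_SLam_hessFFAt_inl_inl`**
  `Σ_α (SΛ κ′ u (x − e_α) x′ (inl α) (inl α′) − SΛ κ′ u x x′ (inl α) (inl α′)) = −Σ_μ Σ'_y c μ y κ′ u · ([x′ = x] + [x′ + e_{α′} = x] − [r_{(μ,y)} = x] − [r_{(μ,y)} + L·e_μ = x]) · q¹,ρ_{(μ,y)}(α′, x′) ∕ 2`
  (a `c`-weighted sum of first-order kernels at the four contact sites — NO curl–curl operator), and the `dψ`-form **`tsum_dz_mul_SLam_hessFFAt`**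
  `Σ'_x Σ_α (dz ψ) α x · SΛ κ′ u x x′ (inl α) (inl α′) = −Σ_μ Σ'_y c μ y κ′ u · (ψ x′ + ψ(x′ + e_{α′}) − ψ(r_{(μ,y)}) − ψ(r_{(μ,y)} + L·e_μ)) · q¹,ρ_{(μ,y)}(α′, x′) ∕ 2`,
  for EVERY `ψ` and EVERY coefficient family `c`; the second slot by `SLam_hessFFAt_antisymm`.
NOT HERE: the (0.4)-symmetrised table `symHessFFAt` (an1's functional law `SymAveragingWardRooted.symSkewHessAt_grad_left` exists; packing on request); any
contact CELL or estimate (owner's CT-3m design); nothing about `lamCoeffK`'s values.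
Provenance: seat b2b-balaban-gan24-formalise-leaf-02 gen 47 (prover-…-leaf-02-g47-0), 2026-08-21; over an1's node 7aρ∕8ρ files and `InterLevelTransport.SLam` BY NAME.
-/

open Finset
open scoped BigOperators
open Literature.MathematicalPhysics.QuantumFieldTheory.Balaban1983to89
open Literature.MathematicalPhysics.QuantumFieldTheory.Balaban1983to89.Beta
open AffineAveraging AveragingContours AveragingHessianKernels AveragingContoursRooted AveragingHessianKernelsRooted
open ExpKernelCalculus (MKer)
open OneStepResolventKernel (Fib)
open InterLevelTransport (SLam cwsum cwsum_apply)
open Summit.QuantumFields.BalabanUV.Beta.AveragingWardRootedKernels (hessKerAt_div_left)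
open Summit.QuantumFields.BalabanUV.Beta.LinearGaugeVH (nearBox mem_nearBox summable_of_finsupp)
open Summit.QuantumFields.BalabanUV.Beta.GAN24.BorderGaugeLegContact (tsum_sum_dz_mul_eq)

noncomputable section

namespace Summit.QuantumFields.BalabanUV.Beta.GAN24.HessianGaugeLegContact

variable {d : ℕ}

/-! ## §1 The constraint-Hessian table `hessFFAt ρ L μ y` -/

section Hessian

/-- [folklore] **THE FLUCTUATION-SLOT PURE-GAUGE LAW OF THE ROOTED CONSTRAINT HESSIAN, FIRST SLOT**: for the coarse bond `b = (μ, y)` with root `r_b = L·y + ρ`,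
`Σ_α (H_b (x − e_α) x′ (inl α) (inl α′) − H_b x x′ (inl α) (inl α′)) = ([x′ = x] + [x′ + e_{α′} = x] − [r_b = x] − [r_b + L·e_μ = x]) · q¹,ρ_b(α′, x′) ∕ 2`
— an1's (K-H)ρ `hessKerAt_div_left` read on the packed block. -/
theorem gaugeLeg_hessFFAt_inl_inl {L : ℕ} (hL : 1 ≤ L) (ρ : Fin (d + 1) → ℤ) (μ : Fin (d + 1)) (y x x' : Fin (d + 1) → ℤ) (α' : Fin (d + 1)) :
    (∑ α, (hessFFAt ρ L μ y (x - unitVec α) x' (Sum.inl α) (Sum.inl α') - hessFFAt ρ L μ y x x' (Sum.inl α) (Sum.inl α')))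
      = ((if x' = x then 1 else 0) + (if x' + unitVec α' = x then 1 else 0)
          - (if (L : ℤ) • y + ρ = x then 1 else 0) - (if (L : ℤ) • y + ρ + (L : ℤ) • unitVec μ = x then 1 else 0))
        * linKerAt ρ L μ y (α', x') / 2 := by
  simp only [hessFFAt_inl_inl]
  exact hessKerAt_div_left hL ρ μ y x (α', x')

/-- [folklore] **… SECOND SLOT** (antisymmetry `hessFFAt_antisymm`; opposite sign, roles of the two fluctuation bonds exchanged). -/
theorem gaugeLeg_hessFFAt_inl_inl_right {L : ℕ} (hL : 1 ≤ L) (ρ : Fin (d + 1) → ℤ) (μ : Fin (d + 1)) (y x x' : Fin (d + 1) → ℤ) (α : Fin (d + 1)) :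
    (∑ α', (hessFFAt ρ L μ y x (x' - unitVec α') (Sum.inl α) (Sum.inl α') - hessFFAt ρ L μ y x x' (Sum.inl α) (Sum.inl α')))
      = -(((if x = x' then 1 else 0) + (if x + unitVec α = x' then 1 else 0)
          - (if (L : ℤ) • y + ρ = x' then 1 else 0) - (if (L : ℤ) • y + ρ + (L : ℤ) • unitVec μ = x' then 1 else 0))
        * linKerAt ρ L μ y (α, x) / 2) := by
  rw [← gaugeLeg_hessFFAt_inl_inl hL ρ μ y x' x α, ← Finset.sum_neg_distrib]
  refine Finset.sum_congr rfl fun α' _ => ?_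
  rw [hessFFAt_antisymm ρ L μ y (x' - unitVec α') x (Sum.inl α') (Sum.inl α), hessFFAt_antisymm ρ L μ y x' x (Sum.inl α') (Sum.inl α)]
  ring

/-- [folklore] Kronecker pairing with four contact sites: `Σ'_x ψ x · ([a = x] + [b = x] − [p = x] − [q = x]) · c = (ψ a + ψ b − ψ p − ψ q) · c`. -/
theorem tsum_mul_ite4_mul (ψ : (Fin (d + 1) → ℤ) → ℝ) (a b p q : Fin (d + 1) → ℤ) (c : ℝ) :
    ∑' x, ψ x * (((if a = x then (1 : ℝ) else 0) + (if b = x then 1 else 0) - (if p = x then 1 else 0) - (if q = x then 1 else 0)) * c)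
      = (ψ a + ψ b - ψ p - ψ q) * c := by
  have hone : ∀ (e : Fin (d + 1) → ℤ), (fun x => ψ x * ((if e = x then (1 : ℝ) else 0) * c)) = fun x => if x = e then ψ e * c else 0 := by
    intro e; funext x
    by_cases h : x = e
    · subst h; simp
    · have h' : ¬ e = x := fun h2 => h h2.symm
      simp [h, h']
  have hs : ∀ (e : Fin (d + 1) → ℤ), Summable fun x => ψ x * ((if e = x then (1 : ℝ) else 0) * c) := by
    intro e; rw [hone e]
    exact summable_of_finsupp {e} fun x hx => by rw [Finset.mem_singleton] at hx; simp [hx]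
  have ht : ∀ (e : Fin (d + 1) → ℤ), ∑' x, ψ x * ((if e = x then (1 : ℝ) else 0) * c) = ψ e * c := by
    intro e; rw [hone e, tsum_ite_eq]
  have hsplit : ∀ x, ψ x * (((if a = x then (1 : ℝ) else 0) + (if b = x then 1 else 0) - (if p = x then 1 else 0) - (if q = x then 1 else 0)) * c)
      = ψ x * ((if a = x then (1 : ℝ) else 0) * c) + ψ x * ((if b = x then (1 : ℝ) else 0) * c)
        - ψ x * ((if p = x then (1 : ℝ) else 0) * c) - ψ x * ((if q = x then (1 : ℝ) else 0) * c) := by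
    intro x; ring
  rw [tsum_congr hsplit, Summable.tsum_sub (((hs a).add (hs b)).sub (hs p)) (hs q), Summable.tsum_sub ((hs a).add (hs b)) (hs p),
    Summable.tsum_add (hs a) (hs b), ht, ht, ht, ht]
  ring

/-- [folklore] **THE FIRST-SLOT LAW PAIRED WITH ANY GAUGE FUNCTION** (every root):
`Σ'_x ψ x · Σ_α (H_b (x − e_α) x′ (inl α) (inl α′) − H_b x x′ (inl α) (inl α′)) = (ψ x′ + ψ(x′ + e_{α′}) − ψ(r_b) − ψ(r_b + L·e_μ)) · q¹,ρ_b(α′, x′) ∕ 2`. -/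
theorem gaugeLeg_hessFFAt_tsum {L : ℕ} (hL : 1 ≤ L) (ρ : Fin (d + 1) → ℤ) (μ : Fin (d + 1)) (y x' : Fin (d + 1) → ℤ) (α' : Fin (d + 1))
    (ψ : (Fin (d + 1) → ℤ) → ℝ) :
    ∑' x, ψ x * ∑ α, (hessFFAt ρ L μ y (x - unitVec α) x' (Sum.inl α) (Sum.inl α') - hessFFAt ρ L μ y x x' (Sum.inl α) (Sum.inl α'))
      = (ψ x' + ψ (x' + unitVec α') - ψ ((L : ℤ) • y + ρ) - ψ ((L : ℤ) • y + ρ + (L : ℤ) • unitVec μ)) * linKerAt ρ L μ y (α', x') / 2 := by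
  simp only [gaugeLeg_hessFFAt_inl_inl hL, mul_div_assoc]
  rw [tsum_mul_ite4_mul]

/-- [folklore] For a box root the table vanishes unless its FIRST fluctuation site lies in the support box of `b` (`hessKerAt_eq_zero_left`). -/
theorem hessFFAt_inl_inl_eq_zero_of_not_mem {L : ℕ} {r : Fin (d + 1) → ℕ} (hr : r ∈ box (d + 1) L) (μ : Fin (d + 1)) (y x' : Fin (d + 1) → ℤ)
    (α α' : Fin (d + 1)) {x : Fin (d + 1) → ℤ} (hx : x ∉ nearBox L y) :
    hessFFAt (toSite r) L μ y x x' (Sum.inl α) (Sum.inl α') = 0 := by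
  rw [mem_nearBox] at hx
  rw [hessFFAt_inl_inl]
  exact hessKerAt_eq_zero_left hr (f := (α, x)) hx _

/-- [folklore] … unless its SECOND fluctuation site lies in the support box (`hessKerAt_eq_zero_right`). -/
theorem hessFFAt_inl_inl_eq_zero_of_not_mem_right {L : ℕ} {r : Fin (d + 1) → ℕ} (hr : r ∈ box (d + 1) L) (μ : Fin (d + 1)) (y x : Fin (d + 1) → ℤ)
    (α α' : Fin (d + 1)) {x' : Fin (d + 1) → ℤ} (hx' : x' ∉ nearBox L y) :
    hessFFAt (toSite r) L μ y x x' (Sum.inl α) (Sum.inl α') = 0 := by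
  rw [mem_nearBox] at hx'
  rw [hessFFAt_inl_inl]
  exact hessKerAt_eq_zero_right hr _ (f' := (α', x')) hx'

/-- [folklore] Any function times the table entry is summable over the first fluctuation site (finite support, box root). -/
theorem summable_mul_hessFFAt {L : ℕ} {r : Fin (d + 1) → ℕ} (hr : r ∈ box (d + 1) L) (μ : Fin (d + 1)) (y x' : Fin (d + 1) → ℤ)
    (α α' : Fin (d + 1)) (g : (Fin (d + 1) → ℤ) → ℝ) :
    Summable fun x => g x * hessFFAt (toSite r) L μ y x x' (Sum.inl α) (Sum.inl α') :=
  summable_of_finsupp (nearBox L y) fun x hx => by rw [hessFFAt_inl_inl_eq_zero_of_not_mem hr μ y x' α α' hx, mul_zero]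

/-- [folklore] **THE `dψ`-FORM, FIRST SLOT** (box root `ρ = toSite r`, `r ∈ box`):
`Σ'_x Σ_α (dz ψ) α x · H_b x x′ (inl α) (inl α′) = (ψ x′ + ψ(x′ + e_{α′}) − ψ(r_b) − ψ(r_b + L·e_μ)) · q¹,ρ_b(α′, x′) ∕ 2`, for EVERY `ψ`. -/
theorem tsum_dz_mul_hessFFAt {L : ℕ} (hL : 1 ≤ L) {r : Fin (d + 1) → ℕ} (hr : r ∈ box (d + 1) L) (μ : Fin (d + 1)) (y x' : Fin (d + 1) → ℤ)
    (α' : Fin (d + 1)) (ψ : (Fin (d + 1) → ℤ) → ℝ) :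
    ∑' x, ∑ α, dz ψ α x * hessFFAt (toSite r) L μ y x x' (Sum.inl α) (Sum.inl α')
      = (ψ x' + ψ (x' + unitVec α') - ψ ((L : ℤ) • y + toSite r) - ψ ((L : ℤ) • y + toSite r + (L : ℤ) • unitVec μ))
        * linKerAt (toSite r) L μ y (α', x') / 2 := by
  rw [tsum_sum_dz_mul_eq (fun α x => hessFFAt (toSite r) L μ y x x' (Sum.inl α) (Sum.inl α'))
    (fun α g => summable_mul_hessFFAt hr μ y x' α α' g) ψ]
  exact gaugeLeg_hessFFAt_tsum hL (toSite r) μ y x' α' ψ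

/-- [folklore] **THE `dψ`-FORM, SECOND SLOT**: `Σ'_{x′} Σ_{α′} H_b x x′ (inl α) (inl α′) · (dz ψ) α′ x′ = −(ψ x + ψ(x + e_α) − ψ(r_b) − ψ(r_b + L·e_μ)) · q¹,ρ_b(α, x) ∕ 2`. -/
theorem tsum_hessFFAt_mul_dz {L : ℕ} (hL : 1 ≤ L) {r : Fin (d + 1) → ℕ} (hr : r ∈ box (d + 1) L) (μ : Fin (d + 1)) (y x : Fin (d + 1) → ℤ)
    (α : Fin (d + 1)) (ψ : (Fin (d + 1) → ℤ) → ℝ) :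
    ∑' x', ∑ α', hessFFAt (toSite r) L μ y x x' (Sum.inl α) (Sum.inl α') * dz ψ α' x'
      = -((ψ x + ψ (x + unitVec α) - ψ ((L : ℤ) • y + toSite r) - ψ ((L : ℤ) • y + toSite r + (L : ℤ) • unitVec μ))
        * linKerAt (toSite r) L μ y (α, x) / 2) := by
  have h : ∀ x', ∑ α', hessFFAt (toSite r) L μ y x x' (Sum.inl α) (Sum.inl α') * dz ψ α' x'
      = -(∑ α', dz ψ α' x' * hessFFAt (toSite r) L μ y x' x (Sum.inl α') (Sum.inl α)) := by
    intro x'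
    rw [← Finset.sum_neg_distrib]
    refine Finset.sum_congr rfl fun α' _ => ?_
    rw [hessFFAt_antisymm (toSite r) L μ y x' x (Sum.inl α') (Sum.inl α)]
    ring
  rw [tsum_congr h, tsum_neg, tsum_dz_mul_hessFFAt hL hr μ y x α ψ]

end Hessian

/-! ## §2 The Λ-piece `SLam N c (hessFFAt ρ L)` -/

section Lambda

/-- [folklore] THE COARSE INDICES WHOSE SUPPORT BOX CONTAINS A GIVEN FINE SITE FORM A FINITE SET (`1 ≤ L`): `Near L y x′ ⇒ x′_i∕L − 1 ≤ y_i ≤ x′_i∕L`. -/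
theorem exists_finset_near {L : ℕ} (hL : 1 ≤ L) (x' : Fin (d + 1) → ℤ) :
    ∃ s : Finset (Fin (d + 1) → ℤ), ∀ y, Near L y x' → y ∈ s := by
  refine ⟨Fintype.piFinset fun i => Finset.Icc (x' i / (L : ℤ) - 1) (x' i / (L : ℤ)), fun y hy => ?_⟩
  rw [Fintype.mem_piFinset]
  intro i
  rw [Finset.mem_Icc]
  have hL0 : (0 : ℤ) < (L : ℤ) := by exact_mod_cast hL
  obtain ⟨h1, h2⟩ := hy i
  constructor
  · have h3 : x' i < (y i + 2) * (L : ℤ) := by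
      have h2' : x' i ≤ (L : ℤ) * y i + (2 * (L : ℤ) - 1) := h2
      linarith
    have h4 : x' i / (L : ℤ) < y i + 2 := Int.ediv_lt_of_lt_mul hL0 h3
    linarith
  · exact Int.le_ediv_of_mul_le hL0 (by rw [mul_comm]; exact h1)

variable {N : ℕ} [NeZero N]

/-- [folklore] THE ENTRY FORMULA of the Λ-piece at the rooted Hessian tables, field–field block:
`SLam N c (hessFFAt ρ L) κ′ u x x′ (inl α) (inl α′) = −Σ_μ Σ'_y c μ y κ′ u · h^ρ_{(μ,y)}((α, x), (α′, x′))`. -/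
theorem SLam_hessFFAt_inl_inl (ρ : Fin (d + 1) → ℤ) (L : ℕ) (c : Fin (d + 1) → (Fin (d + 1) → ℤ) → Fin (d + 1) → (Fin (d + 1) → ℤ) → ℝ)
    (κ' : Fin (d + 1)) (u x x' : Fin (d + 1) → ℤ) (α α' : Fin (d + 1)) :
    SLam N c (fun μ y => hessFFAt ρ L μ y) κ' u x x' (Sum.inl α) (Sum.inl α')
      = -∑ μ, ∑' y, c μ y κ' u * hessKerAt ρ L μ y (α, x) (α', x') := by
  simp only [SLam, cwsum_apply, hessFFAt_inl_inl]

/-- [folklore] The Λ-piece vanishes on the `(inl, inr)` block (so does `hessFFAt`). -/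
theorem SLam_hessFFAt_inl_inr (ρ : Fin (d + 1) → ℤ) (L : ℕ) (c : Fin (d + 1) → (Fin (d + 1) → ℤ) → Fin (d + 1) → (Fin (d + 1) → ℤ) → ℝ)
    (κ' : Fin (d + 1)) (u x x' : Fin (d + 1) → ℤ) (α μ' : Fin (d + 1)) :
    SLam N c (fun μ y => hessFFAt ρ L μ y) κ' u x x' (Sum.inl α) (Sum.inr μ') = 0 := by
  simp [SLam, cwsum_apply]

/-- [folklore] The Λ-piece vanishes on the multiplier rows (so does `hessFFAt`). -/
theorem SLam_hessFFAt_inr (ρ : Fin (d + 1) → ℤ) (L : ℕ) (c : Fin (d + 1) → (Fin (d + 1) → ℤ) → Fin (d + 1) → (Fin (d + 1) → ℤ) → ℝ)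
    (κ' : Fin (d + 1)) (u x x' : Fin (d + 1) → ℤ) (μ' : Fin (d + 1)) (b : Fib d) :
    SLam N c (fun μ y => hessFFAt ρ L μ y) κ' u x x' (Sum.inr μ') b = 0 := by
  simp [SLam, cwsum_apply]

/-- [folklore] **THE Λ-PIECE IS ANTISYMMETRIC** under the exchange of its two kernel slots (it inherits `hessFFAt_antisymm` termwise). -/
theorem SLam_hessFFAt_antisymm (ρ : Fin (d + 1) → ℤ) (L : ℕ) (c : Fin (d + 1) → (Fin (d + 1) → ℤ) → Fin (d + 1) → (Fin (d + 1) → ℤ) → ℝ)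
    (κ' : Fin (d + 1)) (u x x' : Fin (d + 1) → ℤ) (a b : Fib d) :
    SLam N c (fun μ y => hessFFAt ρ L μ y) κ' u x' x b a = -SLam N c (fun μ y => hessFFAt ρ L μ y) κ' u x x' a b := by
  simp only [SLam, cwsum_apply, neg_neg]
  rw [← Finset.sum_neg_distrib]
  refine Finset.sum_congr rfl fun μ _ => ?_
  rw [← tsum_neg]
  refine tsum_congr fun y => ?_
  rw [hessFFAt_antisymm ρ L μ y x x' a b]
  ring

/-- [folklore] For a box root, the coarse sum of the Λ-piece entry is FINITE: it runs over the coarse bonds whose support box contains the second fluctuation site. -/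
theorem tsum_coeff_mul_hessKerAt_eq_sum {L : ℕ} {r : Fin (d + 1) → ℕ} (hr : r ∈ box (d + 1) L) {s : Finset (Fin (d + 1) → ℤ)} {x' : Fin (d + 1) → ℤ}
    (hs : ∀ y, Near L y x' → y ∈ s) (w : (Fin (d + 1) → ℤ) → ℝ) (μ : Fin (d + 1)) (f : Bond (d + 1)) (α' : Fin (d + 1)) :
    ∑' y, w y * hessKerAt (toSite r) L μ y f (α', x') = ∑ y ∈ s, w y * hessKerAt (toSite r) L μ y f (α', x') :=
  tsum_eq_sum fun y hy => by rw [hessKerAt_eq_zero_right hr f (f' := (α', x')) (fun h => hy (hs y h)), mul_zero]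

/-- [folklore] **THE FLUCTUATION-SLOT PURE-GAUGE LAW OF THE Λ-PIECE, FIRST SLOT, ENTRYWISE** (box root `ρ = toSite r`, `r ∈ box`; ANY coefficient family `c`):
`Σ_α (SΛ κ′ u (x − e_α) x′ (inl α) (inl α′) − SΛ κ′ u x x′ (inl α) (inl α′))
  = −Σ_μ Σ'_y c μ y κ′ u · ([x′ = x] + [x′ + e_{α′} = x] − [L·y + ρ = x] − [L·y + ρ + L·e_μ = x]) · q¹,ρ_{(μ,y)}(α′, x′) ∕ 2`. -/
theorem gaugeLeg_SLam_hessFFAt_inl_inl {L : ℕ} (hL : 1 ≤ L) {r : Fin (d + 1) → ℕ} (hr : r ∈ box (d + 1) L)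
    (c : Fin (d + 1) → (Fin (d + 1) → ℤ) → Fin (d + 1) → (Fin (d + 1) → ℤ) → ℝ) (κ' : Fin (d + 1)) (u x x' : Fin (d + 1) → ℤ) (α' : Fin (d + 1)) :
    (∑ α, (SLam N c (fun μ y => hessFFAt (toSite r) L μ y) κ' u (x - unitVec α) x' (Sum.inl α) (Sum.inl α')
        - SLam N c (fun μ y => hessFFAt (toSite r) L μ y) κ' u x x' (Sum.inl α) (Sum.inl α')))
      = -∑ μ, ∑' y, c μ y κ' u *
          ((((if x' = x then 1 else 0) + (if x' + unitVec α' = x then 1 else 0)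
              - (if (L : ℤ) • y + toSite r = x then 1 else 0) - (if (L : ℤ) • y + toSite r + (L : ℤ) • unitVec μ = x then 1 else 0))
            * linKerAt (toSite r) L μ y (α', x') / 2)) := by
  obtain ⟨s, hs⟩ := exists_finset_near hL x'
  have hR : ∀ μ, ∑' y, c μ y κ' u *
      ((((if x' = x then 1 else 0) + (if x' + unitVec α' = x then 1 else 0)
          - (if (L : ℤ) • y + toSite r = x then 1 else 0) - (if (L : ℤ) • y + toSite r + (L : ℤ) • unitVec μ = x then 1 else 0))
        * linKerAt (toSite r) L μ y (α', x') / 2))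
      = ∑ y ∈ s, c μ y κ' u *
      ((((if x' = x then 1 else 0) + (if x' + unitVec α' = x then 1 else 0)
          - (if (L : ℤ) • y + toSite r = x then 1 else 0) - (if (L : ℤ) • y + toSite r + (L : ℤ) • unitVec μ = x then 1 else 0))
        * linKerAt (toSite r) L μ y (α', x') / 2)) := by
    intro μ
    exact tsum_eq_sum fun y hy => by rw [linKerAt_eq_zero hr (f := (α', x')) (fun h => hy (hs y h))]; ring
  simp only [SLam_hessFFAt_inl_inl, tsum_coeff_mul_hessKerAt_eq_sum hr hs, hR]
  -- finite bookkeeping: `Σ_α (−A(α) − (−B(α))) = −Σ_μ Σ_{y∈s} c · Σ_α (h(x − e_α) − h(x))`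
  have e1 : ∀ α, -(∑ μ, ∑ y ∈ s, c μ y κ' u * hessKerAt (toSite r) L μ y (α, x - unitVec α) (α', x'))
        - -(∑ μ, ∑ y ∈ s, c μ y κ' u * hessKerAt (toSite r) L μ y (α, x) (α', x'))
      = -(∑ μ, ∑ y ∈ s, c μ y κ' u * (hessKerAt (toSite r) L μ y (α, x - unitVec α) (α', x') - hessKerAt (toSite r) L μ y (α, x) (α', x'))) := by
    intro α
    simp only [mul_sub, Finset.sum_sub_distrib]
    ring
  rw [Finset.sum_congr rfl fun α _ => e1 α, Finset.sum_neg_distrib, Finset.sum_comm]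
  congr 1
  refine Finset.sum_congr rfl fun μ _ => ?_
  rw [Finset.sum_comm]
  refine Finset.sum_congr rfl fun y _ => ?_
  rw [← Finset.mul_sum, hessKerAt_div_left hL (toSite r) μ y x (α', x')]

/-- [folklore] For a box root the Λ-piece entry vanishes unless its first fluctuation site lies in the (finite) union of the support boxes of the coarse bonds near
the second site. -/
theorem SLam_hessFFAt_inl_inl_eq_zero_of_not_mem {L : ℕ} {r : Fin (d + 1) → ℕ} (hr : r ∈ box (d + 1) L) {s : Finset (Fin (d + 1) → ℤ)}
    {x' : Fin (d + 1) → ℤ} (hs : ∀ y, Near L y x' → y ∈ s) (c : Fin (d + 1) → (Fin (d + 1) → ℤ) → Fin (d + 1) → (Fin (d + 1) → ℤ) → ℝ)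
    (κ' : Fin (d + 1)) (u : Fin (d + 1) → ℤ) (α α' : Fin (d + 1)) {x : Fin (d + 1) → ℤ} (hx : x ∉ s.biUnion fun y => nearBox L y) :
    SLam N c (fun μ y => hessFFAt (toSite r) L μ y) κ' u x x' (Sum.inl α) (Sum.inl α') = 0 := by
  rw [SLam_hessFFAt_inl_inl, neg_eq_zero]
  refine Finset.sum_eq_zero fun μ _ => ?_
  rw [tsum_coeff_mul_hessKerAt_eq_sum hr hs]
  refine Finset.sum_eq_zero fun y hy => ?_
  have hxy : x ∉ nearBox L y := fun h => hx (Finset.mem_biUnion.2 ⟨y, hy, h⟩)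
  rw [mem_nearBox] at hxy
  rw [hessKerAt_eq_zero_left hr (f := (α, x)) hxy _, mul_zero]

/-- [folklore] Any function times the Λ-piece entry is summable over the first fluctuation site (finite support, box root). -/
theorem summable_mul_SLam_hessFFAt {L : ℕ} (hL : 1 ≤ L) {r : Fin (d + 1) → ℕ} (hr : r ∈ box (d + 1) L)
    (c : Fin (d + 1) → (Fin (d + 1) → ℤ) → Fin (d + 1) → (Fin (d + 1) → ℤ) → ℝ) (κ' : Fin (d + 1)) (u x' : Fin (d + 1) → ℤ) (α α' : Fin (d + 1))
    (g : (Fin (d + 1) → ℤ) → ℝ) :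
    Summable fun x => g x * SLam N c (fun μ y => hessFFAt (toSite r) L μ y) κ' u x x' (Sum.inl α) (Sum.inl α') := by
  obtain ⟨s, hs⟩ := exists_finset_near hL x'
  exact summable_of_finsupp (s.biUnion fun y => nearBox L y) fun x hx => by
    rw [SLam_hessFFAt_inl_inl_eq_zero_of_not_mem hr hs c κ' u α α' hx, mul_zero]

/-- [folklore] Exchanging the lattice sum with a finite coarse double sum: for a family `g μ y x` supported in `y ∈ s` and finitely supported in `x` against `ψ`,
`Σ'_x ψ x · (−Σ_μ Σ'_y g μ y x) = −Σ_μ Σ'_y Σ'_x ψ x · g μ y x`. -/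
theorem tsum_mul_neg_sum_tsum_eq {s : Finset (Fin (d + 1) → ℤ)} (ψ : (Fin (d + 1) → ℤ) → ℝ)
    (g : Fin (d + 1) → (Fin (d + 1) → ℤ) → (Fin (d + 1) → ℤ) → ℝ) (hgs : ∀ μ y x, y ∉ s → g μ y x = 0)
    (hgx : ∀ μ y, Summable fun x => ψ x * g μ y x) :
    ∑' x, ψ x * -∑ μ, ∑' y, g μ y x = -∑ μ, ∑' y, ∑' x, ψ x * g μ y x := by
  have hy : ∀ μ x, ∑' y, g μ y x = ∑ y ∈ s, g μ y x := fun μ x => tsum_eq_sum fun y hy => hgs μ y x hy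
  have hy' : ∀ μ, ∑' y, ∑' x, ψ x * g μ y x = ∑ y ∈ s, ∑' x, ψ x * g μ y x :=
    fun μ => tsum_eq_sum fun y hy => by simp only [hgs μ y _ hy, mul_zero, tsum_zero]
  simp only [hy, hy', mul_neg, Finset.mul_sum, tsum_neg]
  rw [Summable.tsum_finsetSum (fun μ _ => summable_sum fun y _ => hgx μ y)]
  congr 1
  refine Finset.sum_congr rfl fun μ _ => ?_
  exact Summable.tsum_finsetSum (fun y _ => hgx μ y)

/-- [folklore] **THE FLUCTUATION-SLOT LAW OF THE Λ-PIECE PAIRED WITH ANY GAUGE FUNCTION** (box root):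
`Σ'_x ψ x · Σ_α (SΛ κ′ u (x − e_α) x′ … − SΛ κ′ u x x′ …) = −Σ_μ Σ'_y c μ y κ′ u · (ψ x′ + ψ(x′ + e_{α′}) − ψ(L·y + ρ) − ψ(L·y + ρ + L·e_μ)) · q¹,ρ_{(μ,y)}(α′, x′) ∕ 2`. -/
theorem gaugeLeg_SLam_hessFFAt_tsum {L : ℕ} (hL : 1 ≤ L) {r : Fin (d + 1) → ℕ} (hr : r ∈ box (d + 1) L)
    (c : Fin (d + 1) → (Fin (d + 1) → ℤ) → Fin (d + 1) → (Fin (d + 1) → ℤ) → ℝ) (κ' : Fin (d + 1)) (u x' : Fin (d + 1) → ℤ) (α' : Fin (d + 1))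
    (ψ : (Fin (d + 1) → ℤ) → ℝ) :
    ∑' x, ψ x * ∑ α, (SLam N c (fun μ y => hessFFAt (toSite r) L μ y) κ' u (x - unitVec α) x' (Sum.inl α) (Sum.inl α')
        - SLam N c (fun μ y => hessFFAt (toSite r) L μ y) κ' u x x' (Sum.inl α) (Sum.inl α'))
      = -∑ μ, ∑' y, c μ y κ' u *
          ((ψ x' + ψ (x' + unitVec α') - ψ ((L : ℤ) • y + toSite r) - ψ ((L : ℤ) • y + toSite r + (L : ℤ) • unitVec μ))
            * linKerAt (toSite r) L μ y (α', x') / 2) := by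
  obtain ⟨s, hs⟩ := exists_finset_near hL x'
  simp only [gaugeLeg_SLam_hessFFAt_inl_inl hL hr]
  refine (tsum_mul_neg_sum_tsum_eq (s := s) ψ _ (fun μ y x hy => ?_) (fun μ y => ?_)).trans ?_
  · rw [linKerAt_eq_zero hr (f := (α', x')) (fun h => hy (hs y h))]
    ring
  · refine summable_of_finsupp
      ({x', x' + unitVec α', (L : ℤ) • y + toSite r, (L : ℤ) • y + toSite r + (L : ℤ) • unitVec μ} : Finset (Fin (d + 1) → ℤ))
      fun x hx => ?_
    have h1 : x' ≠ x := fun h => hx (by rw [← h]; simp)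
    have h2 : x' + unitVec α' ≠ x := fun h => hx (by rw [← h]; simp)
    have h3 : (L : ℤ) • y + toSite r ≠ x := fun h => hx (by rw [← h]; simp)
    have h4 : (L : ℤ) • y + toSite r + (L : ℤ) • unitVec μ ≠ x := fun h => hx (by rw [← h]; simp)
    rw [if_neg h1, if_neg h2, if_neg h3, if_neg h4]
    ring
  · congr 1
    refine Finset.sum_congr rfl fun μ _ => tsum_congr fun y => ?_
    rw [tsum_congr (fun x => mul_left_comm (ψ x) _ _), tsum_mul_left]
    simp only [mul_div_assoc]
    rw [tsum_mul_ite4_mul]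

/-- [folklore] **THE `dψ`-FORM OF THE Λ-PIECE LAW, FIRST SLOT** (box root; EVERY `ψ`, EVERY coefficient family `c` — so in particular Bałaban's
`c = lamCoeffK (KInvStep Lc (j+1)) (E2 d Lc (j+1)) Lc` at every level):
`Σ'_x Σ_α (dz ψ) α x · SΛ κ′ u x x′ (inl α) (inl α′) = −Σ_μ Σ'_y c μ y κ′ u · (ψ x′ + ψ(x′ + e_{α′}) − ψ(L·y + ρ) − ψ(L·y + ρ + L·e_μ)) · q¹,ρ_{(μ,y)}(α′, x′) ∕ 2`. -/
theorem tsum_dz_mul_SLam_hessFFAt {L : ℕ} (hL : 1 ≤ L) {r : Fin (d + 1) → ℕ} (hr : r ∈ box (d + 1) L)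
    (c : Fin (d + 1) → (Fin (d + 1) → ℤ) → Fin (d + 1) → (Fin (d + 1) → ℤ) → ℝ) (κ' : Fin (d + 1)) (u x' : Fin (d + 1) → ℤ) (α' : Fin (d + 1))
    (ψ : (Fin (d + 1) → ℤ) → ℝ) :
    ∑' x, ∑ α, dz ψ α x * SLam N c (fun μ y => hessFFAt (toSite r) L μ y) κ' u x x' (Sum.inl α) (Sum.inl α')
      = -∑ μ, ∑' y, c μ y κ' u *
          ((ψ x' + ψ (x' + unitVec α') - ψ ((L : ℤ) • y + toSite r) - ψ ((L : ℤ) • y + toSite r + (L : ℤ) • unitVec μ))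
            * linKerAt (toSite r) L μ y (α', x') / 2) := by
  rw [tsum_sum_dz_mul_eq (fun α x => SLam N c (fun μ y => hessFFAt (toSite r) L μ y) κ' u x x' (Sum.inl α) (Sum.inl α'))
    (fun α g => summable_mul_SLam_hessFFAt hL hr c κ' u x' α α' g) ψ]
  exact gaugeLeg_SLam_hessFFAt_tsum hL hr c κ' u x' α' ψ

/-- [folklore] **THE `dψ`-FORM, SECOND SLOT** (antisymmetry): `Σ'_{x′} Σ_{α′} SΛ κ′ u x x′ (inl α) (inl α′) · (dz ψ) α′ x′
  = Σ_μ Σ'_y c μ y κ′ u · (ψ x + ψ(x + e_α) − ψ(L·y + ρ) − ψ(L·y + ρ + L·e_μ)) · q¹,ρ_{(μ,y)}(α, x) ∕ 2`. -/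
theorem tsum_SLam_hessFFAt_mul_dz {L : ℕ} (hL : 1 ≤ L) {r : Fin (d + 1) → ℕ} (hr : r ∈ box (d + 1) L)
    (c : Fin (d + 1) → (Fin (d + 1) → ℤ) → Fin (d + 1) → (Fin (d + 1) → ℤ) → ℝ) (κ' : Fin (d + 1)) (u x : Fin (d + 1) → ℤ) (α : Fin (d + 1))
    (ψ : (Fin (d + 1) → ℤ) → ℝ) :
    ∑' x', ∑ α', SLam N c (fun μ y => hessFFAt (toSite r) L μ y) κ' u x x' (Sum.inl α) (Sum.inl α') * dz ψ α' x'
      = ∑ μ, ∑' y, c μ y κ' u *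
          ((ψ x + ψ (x + unitVec α) - ψ ((L : ℤ) • y + toSite r) - ψ ((L : ℤ) • y + toSite r + (L : ℤ) • unitVec μ))
            * linKerAt (toSite r) L μ y (α, x) / 2) := by
  have h : ∀ x', ∑ α', SLam N c (fun μ y => hessFFAt (toSite r) L μ y) κ' u x x' (Sum.inl α) (Sum.inl α') * dz ψ α' x'
      = -(∑ α', dz ψ α' x' * SLam N c (fun μ y => hessFFAt (toSite r) L μ y) κ' u x' x (Sum.inl α') (Sum.inl α)) := by
    intro x'
    rw [← Finset.sum_neg_distrib]
    refine Finset.sum_congr rfl fun α' _ => ?_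
    rw [SLam_hessFFAt_antisymm (toSite r) L c κ' u x' x (Sum.inl α') (Sum.inl α)]
    ring
  rw [tsum_congr h, tsum_neg, tsum_dz_mul_SLam_hessFFAt hL hr c κ' u x α ψ, neg_neg]

end Lambda

end Summit.QuantumFields.BalabanUV.Beta.GAN24.HessianGaugeLegContact

end
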